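import Summits.Ventures.YMGap.RobustBall.StarContractionZd
import HarnessLib

/-!
# Venture YMGap, track ROBUST-BALL (Y2) — crux «Y2-X2-P», STEP 3 / P3b: THE WEIGHTED STAR WINDOW BOUND OF A SUMMABLE MEMBER FROM
# NEAR ARRAYS AND ABSTRACT FAR LOADS — every rate, every reach

HONEST FRAMING. WHAT THIS IS: a venture file (cell `pub-ymgap`, track Y2 ROBUST-BALL, seat ds-2 (g15); lead R392 (B) STEP 3; theorems only,
0 compute). The tree's `starWindowBoundZdW_of_near` (`RobustStarDoorZdW.lean`) glues the sitewise near windows of the truncations of a member of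
the EXPONENTIALLY weighted ball into the weighted star window bound `StarWindowBoundZdW … t ρ' (fun s y => ‖y.1 − s‖ + 1)`, deriving the far
loads from `e^{κ·diam}` inside the proof. Here the SAME gluing is stated with the far loads as HYPOTHESES and for an ARBITRARY nonnegative reach
and rate `t ≥ 0` (`starWindowBoundZdW_of_near_farLoads`): near arrays `Kn` of the truncations `truncZd D s W ∈ MemBallZdG ε₀ ε₁ (2D)` with
locality radius `D' ≥ 2D + 2` and received sum `ρn` (`StarWindowBoundZdR`), a bound `A` of the weight `e^{t·reach(s,y)}` on the locality box,
the far star-link bound `Σ_{x ∈ ⋆} ℓ_x ≤ FL`, the WEIGHTED far exterior bound `Σ'_y L_y e^{t·reach(s,y)} ≤ FE`, `2√N·FL ≤ τ̄`, and the closing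
inequality `E²·A·ρn + 2√N(E²+E⁴)·FL·(A ρn) + 2·2√N(E²+E⁴)·FE ≤ ρ'` (`E = e^{τ̄}`) give `StarWindowBoundZdW d N (perturbedYMS ρ_N β W) t ρ' reach`
(array `E²Kn + C₁Σℓ_xKn + C₂L_y`, (H1) by `star_contraction_of_farLoads`). With the logarithmic reach `log(1 + (‖y−s‖+1)/D₀)` at rate `q`
and the polynomial far loads of `StarFarLoadsZdP.lean` this is the door of the tier-3 (power-law) ball; with the linear reach it recovers tier 2.
WHAT THIS IS NOT: no number, no cell; strong-coupling LATTICE bookkeeping — nothing about the continuum or the Millennium problem; the tier-3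
target is power-law clustering, weaker than a mass gap.
-/

noncomputable section

open MeasureTheory ProbabilityTheory Function Finset Real
open scoped NNReal
open Literature.Probability.LatticeModels
open Literature.Probability.LatticeModels.DobrushinMetric
open Literature.MathematicalPhysics.QuantumLattice hiding torusNorm
open Literature.MathematicalPhysics.QuantumFieldTheory hiding ZdEdge
open Summit.Ventures.YMGap.DSWindowZd

namespace Summit.Ventures.YMGap.RobustBall

variable {d N : ℕ}

/-- **THE WEIGHTED STAR WINDOW BOUND OF A SUMMABLE MEMBER FROM NEAR ARRAYS AND ABSTRACT FAR LOADS** (every rate `t ≥ 0`, every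
nonnegative reach). See the module docstring. [folklore] -/
theorem starWindowBoundZdW_of_near_farLoads {β ε₀ ε₁ ρn t τb ρ' FL FE A : ℝ} {D D' : ℕ} (hD'eq : 2 * D + 2 ≤ D')
    {reach : Site d → ZdEdge d → ℝ} (ht : 0 ≤ t) (hreach0 : ∀ s y, 0 ≤ reach s y)
    (hA : ∀ (s : Site d) (y : ZdEdge d), y ∈ starNbhdZdR D' s → Real.exp (t * reach s y) ≤ A)
    {W : Potential (ZdEdge d) (SUN N)} (hWc : ∀ X, Continuous (W X))
    (hWdep : ∀ X, DependsOn (W X) (↑X : Set (ZdEdge d))) {Bm : Finset (ZdEdge d) → ℝ}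
    (hBm : IsLinkSummable W Bm) {lip : Finset (ZdEdge d) → ZdEdge d → ℝ}
    (hlip : ∀ X, IsLipBound suFrobDist (W X) (lip X))
    (hn : ∀ s : Site d, MemBallZdG ε₀ ε₁ (2 * D) (truncZd D s W) (truncSuppZd D s))
    (hms : ∀ s : Site d, Summable fun X : Finset (ZdEdge d) =>
      (if (X ∩ vertexStarZd s).Nonempty ∧ ¬ X ⊆ starNbhdZdR D s then ∑ y ∈ X, lip X y else 0))
    (hℓsum : ∀ (s : Site d) (x : ZdEdge d), Summable fun X : Finset (ZdEdge d) =>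
      (if ((X ∩ vertexStarZd s).Nonempty ∧ ¬ X ⊆ starNbhdZdR D s) ∧ x ∈ X then lip X x else 0))
    (hℓle : ∀ s : Site d, ∑ x ∈ vertexStarZd s, ∑' X : Finset (ZdEdge d),
      (if ((X ∩ vertexStarZd s).Nonempty ∧ ¬ X ⊆ starNbhdZdR D s) ∧ x ∈ X then lip X x else 0) ≤ FL)
    (hLw : ∀ s : Site d, (Summable fun y : ZdEdge d => (∑' X : Finset (ZdEdge d),
        (if ((X ∩ vertexStarZd s).Nonempty ∧ ¬ X ⊆ starNbhdZdR D s) ∧ y ∈ X ∧ y ∉ vertexStarZd s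
          then lip X y else 0)) * Real.exp (t * reach s y)) ∧
      ∑' y : ZdEdge d, (∑' X : Finset (ZdEdge d),
        (if ((X ∩ vertexStarZd s).Nonempty ∧ ¬ X ⊆ starNbhdZdR D s) ∧ y ∈ X ∧ y ∉ vertexStarZd s
          then lip X y else 0)) * Real.exp (t * reach s y) ≤ FE)
    (hτb : (2 * Real.sqrt N) * FL ≤ τb)
    (hclose : Real.exp τb ^ 2 * A * ρn +
        (2 * Real.sqrt N) * (Real.exp τb ^ 2 + Real.exp τb ^ 4) * FL * (A * ρn) +
        2 * (2 * Real.sqrt N) * (Real.exp τb ^ 2 + Real.exp τb ^ 4) * FE ≤ ρ')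
    (hnear : ∀ s : Site d, StarWindowBoundZdR d N
      (perturbedYM (d := d) (fundamentalRep (Fin N)) β (truncZd D s W) (truncSuppZd D s)) D' ρn suFrobDist) :
    StarWindowBoundZdW d N (perturbedYMS (d := d) (fundamentalRep (Fin N)) β W) t ρ' reach suFrobDist := by
  classical
  haveI : SecondCountableTopology (Matrix (Fin N) (Fin N) ℂ) :=
    inferInstanceAs (SecondCountableTopology (Fin N → Fin N → ℂ))
  haveI : SecondCountableTopology (SUN N) := Topology.IsEmbedding.subtypeVal.secondCountableTopology
  set ρG := fundamentalRep (Fin N) with hρG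
  have hρc : Continuous ρG := continuous_fundamentalRep (Fin N)
  set Rr : ℝ := 2 * Real.sqrt N with hRr
  have hRr0 : 0 ≤ Rr := by positivity
  -- the near star arrays, one per vertex
  choose Kn hKn0 hKnsupp hKnH1 hKnH2 using hnear
  -- far constants
  set E : ℝ := Real.exp τb with hE
  set C₁ : ℝ := Rr * (E ^ 2 + E ^ 4) with hC₁
  set C₂ : ℝ := 2 * Rr * (E ^ 2 + E ^ 4) with hC₂
  have hE0 : 0 < E := Real.exp_pos _
  have hC₁0 : 0 ≤ C₁ := by positivity
  have hC₂0 : 0 ≤ C₂ := by positivity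
  set ℓ : Site d → ZdEdge d → ℝ := fun s x => ∑' X : Finset (ZdEdge d),
    (if ((X ∩ vertexStarZd s).Nonempty ∧ ¬ X ⊆ starNbhdZdR D s) ∧ x ∈ X then lip X x else 0) with hℓ
  set L : Site d → ZdEdge d → ℝ := fun s y => ∑' X : Finset (ZdEdge d),
    (if ((X ∩ vertexStarZd s).Nonempty ∧ ¬ X ⊆ starNbhdZdR D s) ∧ y ∈ X ∧ y ∉ vertexStarZd s
      then lip X y else 0) with hL
  have hℓ0 : ∀ s x, 0 ≤ ℓ s x := fun s x => tsum_nonneg fun X => by split_ifs; exacts [(hlip X).nonneg x, le_rfl]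
  have hL0 : ∀ s y, 0 ≤ L s y := fun s y => tsum_nonneg fun X => by split_ifs; exacts [(hlip X).nonneg y, le_rfl]
  -- the unweighted far exterior series are summable (weights `≥ 1`)
  have hLsum : ∀ s : Site d, Summable fun y : ZdEdge d => L s y := fun s =>
    Summable.of_nonneg_of_le (fun y => hL0 s y)
      (fun y => by
        calc L s y = L s y * 1 := (mul_one _).symm
          _ ≤ L s y * Real.exp (t * reach s y) :=
            mul_le_mul_of_nonneg_left (Real.one_le_exp (mul_nonneg ht (hreach0 s y))) (hL0 s y))
      (hLw s).1
  -- the array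
  set KZ : Site d → ZdEdge d → ZdEdge d → ℝ := fun s y z => if z ∈ vertexStarZd s then
      E ^ 2 * Kn s s y z + C₁ * (∑ x ∈ vertexStarZd s, ℓ s x * Kn s s y x) + C₂ * L s y else 0 with hKZ
  have hKZ_apply : ∀ s y z, KZ s y z = if z ∈ vertexStarZd s then
      E ^ 2 * Kn s s y z + C₁ * (∑ x ∈ vertexStarZd s, ℓ s x * Kn s s y x) + C₂ * L s y else 0 :=
    fun _ _ _ => rfl
  have hKZ' : ∀ s y z, KZ s y z = if z ∈ vertexStarZd s then
      Real.exp τb ^ 2 * Kn s s y z +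
        (2 * Real.sqrt ((N : ℕ) : ℝ)) * (Real.exp τb ^ 2 + Real.exp τb ^ 4) *
          (∑ x ∈ vertexStarZd s, (∑' X : Finset (ZdEdge d),
            (if ((X ∩ vertexStarZd s).Nonempty ∧ ¬ X ⊆ starNbhdZdR D s) ∧ x ∈ X then lip X x else 0)) * Kn s s y x) +
        2 * (2 * Real.sqrt ((N : ℕ) : ℝ)) * (Real.exp τb ^ 2 + Real.exp τb ^ 4) *
          (∑' X : Finset (ZdEdge d),
            (if ((X ∩ vertexStarZd s).Nonempty ∧ ¬ X ⊆ starNbhdZdR D s) ∧ y ∈ X ∧ y ∉ vertexStarZd s then lip X y else 0))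
      else 0 := by
    intro s y z
    rw [hKZ_apply]
  refine ⟨KZ, ?_, ?_, ?_, ?_⟩
  · -- nonnegativity
    intro s y z
    rw [hKZ_apply]
    split_ifs
    · refine add_nonneg (add_nonneg (mul_nonneg (pow_nonneg hE0.le _) (hKn0 s s y z))
        (mul_nonneg hC₁0 (Finset.sum_nonneg fun x _ => mul_nonneg (hℓ0 s x) (hKn0 s s y x)))) (mul_nonneg hC₂0 (hL0 s y))
    · exact le_rfl
  · -- weighted summability
    intro s z
    by_cases hz : z ∈ vertexStarZd s
    · simp only [hKZ_apply, if_pos hz]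
      have hfin : ∀ (g : ZdEdge d → ℝ), Summable fun y => Kn s s y z * g y := fun g =>
        summable_of_ne_finset_zero (s := starNbhdZdR D' s) fun y hy => by
          rw [show Kn s s y z = 0 from by_contra fun h => hy (hKnsupp s s y z h), zero_mul]
      have hfin' : ∀ (x : ZdEdge d) (g : ZdEdge d → ℝ), Summable fun y => Kn s s y x * g y := fun x g =>
        summable_of_ne_finset_zero (s := starNbhdZdR D' s) fun y hy => by
          rw [show Kn s s y x = 0 from by_contra fun h => hy (hKnsupp s s y x h), zero_mul]
      have h3 : Summable fun y => C₂ * L s y * Real.exp (t * reach s y) := by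
        have := (hLw s).1.mul_left C₂
        refine this.congr fun y => by ring
      have h2 : Summable fun y => C₁ * (∑ x ∈ vertexStarZd s, ℓ s x * Kn s s y x) * Real.exp (t * reach s y) := by
        have : Summable fun y => ∑ x ∈ vertexStarZd s, C₁ * ℓ s x * (Kn s s y x * Real.exp (t * reach s y)) :=
          summable_sum fun x _ => (hfin' x _).mul_left _
        refine this.congr fun y => ?_
        rw [Finset.mul_sum, Finset.sum_mul]
        exact Finset.sum_congr rfl fun x _ => by ring
      have h1 : Summable fun y => E ^ 2 * Kn s s y z * Real.exp (t * reach s y) := by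
        have := (hfin fun y => Real.exp (t * reach s y)).mul_left (E ^ 2)
        refine this.congr fun y => by ring
      refine ((h1.add h2).add h3).congr fun y => by ring
    · simp only [hKZ_apply, if_neg hz, zero_mul]; exact summable_zero
  · -- (H1), global form: the one-centre contraction theorem
    intro c ω η f δ hfm hfB hfdep hδ0 hδ
    exact star_contraction_of_farLoads hD'eq hWc hWdep hBm hlip hn hms hℓsum hℓle hLsum hτb hKn0 hKnsupp hKnH1
      hKZ' c ω η f δ hfm hfB hfdep hδ0 hδ
  · -- (H2), weighted received sums
    intro s z hz
    simp only [hKZ_apply, if_pos hz]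
    have hA0 : 0 ≤ A := by
      have hz' : z ∈ starNbhdZdR D' s := vertexStarZd_subset_starNbhdZdR (by omega) s hz
      exact (Real.exp_pos _).le.trans (hA s z hz')
    have hw : ∀ y ∈ starNbhdZdR D' s, Real.exp (t * reach s y) ≤ A := fun y hy => hA s y hy
    have hKw : ∀ x ∈ vertexStarZd s, ∑' y, Kn s s y x * Real.exp (t * reach s y) ≤ A * ρn := by
      intro x hx
      rw [tsum_eq_sum (s := starNbhdZdR D' s) fun y hy => by
        rw [show Kn s s y x = 0 from by_contra fun h' => hy (hKnsupp s s y x h'), zero_mul]]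
      calc ∑ y ∈ starNbhdZdR D' s, Kn s s y x * Real.exp (t * reach s y)
          ≤ ∑ y ∈ starNbhdZdR D' s, Kn s s y x * A :=
            Finset.sum_le_sum fun y hy => mul_le_mul_of_nonneg_left (hw y hy) (hKn0 s s y x)
        _ = A * ∑ y ∈ starNbhdZdR D' s, Kn s s y x := by rw [← Finset.sum_mul, mul_comm]
        _ ≤ A * ρn := mul_le_mul_of_nonneg_left (hKnH2 s s x hx) hA0
    have hKsw : ∀ x, Summable fun y => Kn s s y x * Real.exp (t * reach s y) := fun x =>
      summable_of_ne_finset_zero (s := starNbhdZdR D' s) fun y hy => by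
        rw [show Kn s s y x = 0 from by_contra fun h' => hy (hKnsupp s s y x h'), zero_mul]
    have h1 : Summable fun y => E ^ 2 * Kn s s y z * Real.exp (t * reach s y) :=
      ((hKsw z).mul_left (E ^ 2)).congr fun y => by ring
    have h2 : Summable fun y => C₁ * (∑ x ∈ vertexStarZd s, ℓ s x * Kn s s y x) * Real.exp (t * reach s y) := by
      have : Summable fun y => ∑ x ∈ vertexStarZd s, C₁ * ℓ s x * (Kn s s y x * Real.exp (t * reach s y)) :=
        summable_sum fun x _ => (hKsw x).mul_left _
      refine this.congr fun y => ?_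
      rw [Finset.mul_sum, Finset.sum_mul]; exact Finset.sum_congr rfl fun x _ => by ring
    have h3 : Summable fun y => C₂ * L s y * Real.exp (t * reach s y) :=
      ((hLw s).1.mul_left C₂).congr fun y => by ring
    have hsplit3 : (fun y => (E ^ 2 * Kn s s y z + C₁ * (∑ x ∈ vertexStarZd s, ℓ s x * Kn s s y x) + C₂ * L s y) *
        Real.exp (t * reach s y)) = fun y => E ^ 2 * Kn s s y z * Real.exp (t * reach s y) +
          C₁ * (∑ x ∈ vertexStarZd s, ℓ s x * Kn s s y x) * Real.exp (t * reach s y) +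
          C₂ * L s y * Real.exp (t * reach s y) := by funext y; ring
    rw [hsplit3, (h1.add h2).tsum_add h3, h1.tsum_add h2]
    have e1 : ∑' y, E ^ 2 * Kn s s y z * Real.exp (t * reach s y) ≤ E ^ 2 * (A * ρn) := by
      rw [show (fun y => E ^ 2 * Kn s s y z * Real.exp (t * reach s y)) =
        fun y => E ^ 2 * (Kn s s y z * Real.exp (t * reach s y)) from funext fun y => by ring, tsum_mul_left]
      exact mul_le_mul_of_nonneg_left (hKw z hz) (pow_nonneg hE0.le _)
    have e2 : ∑' y, C₁ * (∑ x ∈ vertexStarZd s, ℓ s x * Kn s s y x) * Real.exp (t * reach s y) ≤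
        C₁ * (FL * (A * ρn)) := by
      have : ∀ y, C₁ * (∑ x ∈ vertexStarZd s, ℓ s x * Kn s s y x) * Real.exp (t * reach s y) =
          ∑ x ∈ vertexStarZd s, C₁ * ℓ s x * (Kn s s y x * Real.exp (t * reach s y)) := fun y => by
        rw [Finset.mul_sum, Finset.sum_mul]; exact Finset.sum_congr rfl fun x _ => by ring
      simp_rw [this]
      rw [Summable.tsum_finsetSum (fun x _ => (hKsw x).mul_left _)]
      simp_rw [tsum_mul_left]
      calc ∑ x ∈ vertexStarZd s, C₁ * ℓ s x * ∑' y, Kn s s y x * Real.exp (t * reach s y)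
          ≤ ∑ x ∈ vertexStarZd s, C₁ * ℓ s x * (A * ρn) :=
            Finset.sum_le_sum fun x hx => mul_le_mul_of_nonneg_left (hKw x hx) (mul_nonneg hC₁0 (hℓ0 s x))
        _ = C₁ * ((∑ x ∈ vertexStarZd s, ℓ s x) * (A * ρn)) := by
            rw [Finset.sum_mul, Finset.mul_sum]; exact Finset.sum_congr rfl fun x _ => by ring
        _ ≤ C₁ * (FL * (A * ρn)) := by
            refine mul_le_mul_of_nonneg_left (mul_le_mul_of_nonneg_right (hℓle s) ?_) hC₁0
            exact le_trans (tsum_nonneg fun y => mul_nonneg (hKn0 s s y z) (Real.exp_pos _).le) (hKw z hz)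
    have e3 : ∑' y, C₂ * L s y * Real.exp (t * reach s y) ≤ C₂ * FE := by
      rw [show (fun y => C₂ * L s y * Real.exp (t * reach s y)) =
        fun y => C₂ * (L s y * Real.exp (t * reach s y)) from funext fun y => by ring, tsum_mul_left]
      exact mul_le_mul_of_nonneg_left (hLw s).2 hC₂0
    refine le_trans (add_le_add (add_le_add e1 e2) e3) (le_trans (le_of_eq ?_) hclose)
    rw [hC₁, hC₂, hE, hRr]
    ring

end Summit.Ventures.YMGap.RobustBall

end
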